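import Summits.HodgeConjecture.HodgeCM.Model.Sanity.PinThetaCollapse_1

/-! PORT of `HodgeCM/Model/Sanity/PinThetaCollapse.lean` (HodgeCMPerL run 82) — part 2: continuation of `Summits.HodgeConjecture.HodgeCM.Model.Sanity.PinThetaCollapse_1` (split at a top-level declaration boundary by port_pkg.py; scope re-opened below; declarations unchanged). -/

-- port_pkg: scope re-opened for this part (file-level context, then the namespace/section stack open at the cut)
set_option autoImplicit false
noncomputable section
open MulAction
open HodgeCM.Model.ThetaSpace
open Literature.Geometry.ComplexHyperbolic.BallModel (U21 Ball x₀)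
open Literature.NumberTheory.Automorphic Literature.NumberTheory.Automorphic.WeightForms Literature.NumberTheory.Weil1964
open Literature.AlgebraicGeometry.HodgeTheory Literature.AlgebraicGeometry.ShimuraVarieties
open Literature.NumberTheory.Automorphic.PicardCM
open HodgeCM.Model.SupplyInstance HodgeCM.Model.SupplyResidual
open scoped SchwartzMap Classical Matrix
namespace HodgeCM
namespace Model
namespace Sanity
section PinCollapse
open HodgeCM.Universe (SideData ThetaModel)
variable (hHD : exists_isReal_hodgeModel) (hI : hodgePQ_independent_of_hodgeModel)
  (h₁ : BallQuotientUniformised)  (h₃ : CMAbelianVarietyRealised)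
variable (h : Bool)
  (emb : ∀ {L : CMField} {ι₁ : L →+* ℂ} {V : HermSpace3 L ι₁} (Γ : Level V),
    (picardCMUniverse hHD hI h₁ h₃).CohC ((picardCMUniverse hHD hI h₁ h₃).pms L ι₁ V Γ) 2 →ₗ[ℂ]
      (V.latticeModel printFact_unitaryCompact_holds).toQuotientModel.H)
  (cover : ∀ {L : CMField} {ι₁ : L →+* ℂ} {V : HermSpace3 L ι₁} (Γ Γ' : Level V),
    Γ'.Γ ≤ Γ.Γ → (picardCMUniverse hHD hI h₁ h₃).Mor ((picardCMUniverse hHD hI h₁ h₃).pms L ι₁ V Γ')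
      ((picardCMUniverse hHD hI h₁ h₃).pms L ι₁ V Γ))
  (wm : ∀ {L : CMField} {ι₁ : L →+* ℂ} (V : HermSpace3 L ι₁) (c : SeesawCtx L),
    WeilThetaModel (V.latticeModel printFact_unitaryCompact_holds).toQuotientModel.G
      (V.latticeModel printFact_unitaryCompact_holds).toQuotientModel.Γ
      (c.D.latticeModelW printFact_unitaryCompact_holds).toQuotientModel.G
      (c.D.latticeModelW printFact_unitaryCompact_holds).toQuotientModel.Γ)
  (d12 d34 : ∀ {L : CMField}, SeesawCtx L → SideData L)
/-- **Headline 3 (R9's `hLiu` over `degS`): free in a good context (the degree hypothesis is not even used).** -/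
theorem hLiu_degS {L : CMField} {ι₁ : L →+* ℂ} (V : HermSpace3 L ι₁) (c : SeesawCtx L)
    (hc : (thetaModelOf hHD hI h₁ h₃ h emb cover wm
      (thetaOf _ (thetaClassInputOf _ (fun V c => thetaSpaceInputOf hHD hI h₁ h₃ degS V c))) d12 d34).GoodCtx ι₁ c)
    (_hK : Module.finrank ℚ c.K = 6) (i : Fin 4) (Γ : Level V) :
    ∃ (M : CMField) (k : c.K →+* M) (σ' : M →+* ℂ), σ'.comp k = c.σ ∧
      (thetaModelOf hHD hI h₁ h₃ h emb cover wm
        (thetaOf _ (thetaClassInputOf _ (fun V c => thetaSpaceInputOf hHD hI h₁ h₃ degS V c))) d12 d34).Theta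
          V c i Γ ⊆ (picardCMUniverse hHD hI h₁ h₃).Uiso Γ M (HodgeCM.CMTypeOps.inflate k (c.Ψ i)) σ' :=
  hLiu_of_collapse _ V c (theta_thetaModelOf_degS_eq hHD hI h₁ h₃ h emb cover wm d12 d34 V c) hc i Γ

/-- **Headline 4 (stage-1 `thetaWedge` / `Open_thetaWedge` body over `degS`): REFUTED at every context.** -/
theorem not_thetaWedgeAt_degS {L : CMField} {ι₁ : L →+* ℂ} (V : HermSpace3 L ι₁) (c : SeesawCtx L) :
    ¬ (thetaModelOf hHD hI h₁ h₃ h emb cover wm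
      (thetaOf _ (thetaClassInputOf _ (fun V c => thetaSpaceInputOf hHD hI h₁ h₃ degS V c))) d12 d34).ThetaWedgeAt
        V c :=
  not_thetaWedgeAt_of_collapse _ V c (theta_thetaModelOf_degS_eq hHD hI h₁ h₃ h emb cover wm d12 d34 V c)

/-- **Headline 5 (C5′ `Gen12MeetAt` over `degS`): VACUOUSLY TRUE at every context.** -/
theorem gen12MeetAt_degS {L : CMField} {ι₁ : L →+* ℂ} (V : HermSpace3 L ι₁) (c : SeesawCtx L) :
    (thetaModelOf hHD hI h₁ h₃ h emb cover wm
      (thetaOf _ (thetaClassInputOf _ (fun V c => thetaSpaceInputOf hHD hI h₁ h₃ degS V c))) d12 d34).Gen12MeetAt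
        V c :=
  gen12MeetAt_of_collapse _ V c (theta_thetaModelOf_degS_eq hHD hI h₁ h₃ h emb cover wm d12 d34 V c)

/-- **Headline 6 (`ThetaSubAt` over `degS`): FREE at every context.** -/
theorem thetaSubAt_degS {L : CMField} {ι₁ : L →+* ℂ} (V : HermSpace3 L ι₁) (c : SeesawCtx L) :
    (thetaModelOf hHD hI h₁ h₃ h emb cover wm
      (thetaOf _ (thetaClassInputOf _ (fun V c => thetaSpaceInputOf hHD hI h₁ h₃ degS V c))) d12 d34).ThetaSubAt
        V c :=
  thetaSubAt_of_collapse _ V c (theta_thetaModelOf_degS_eq hHD hI h₁ h₃ h emb cover wm d12 d34 V c)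

end PinCollapse

end Sanity
end Model
end HodgeCM

end
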